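import Mathlib
import HarnessLib
import Literature.NumberTheory.Sieve.BatemanHorn
import Summits.Parity.BatemanHorn.Theorems.AlmostPrimeZerosSystemZeroRepulsionEulerAdditivity
import Summits.Parity.BatemanHorn.Theorems.AlmostPrimeZerosSystemZeroRepulsionLocalStructure
import Summits.Parity.BatemanHorn.Theorems.AlmostPrimeZerosSystemZeroRepulsionLocalRootBound

/-!
# The Euler share of the almost-prime zero functional is bounded (`stub_eulerSpeciesBound`)

Line `euler-species-factorisation` of crux stmt-Parity-11291
(`Summit.Parity.BatemanHorn.Theses.AlmostPrimeZeros.SystemZeroRepulsion`): the planner's stub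
`stub_eulerSpeciesBound`, DERIVED from the three landed registered stubs E1 `stub_eulerAdditivity` (p80062),
E2 `stub_localStructure` (p82948), E3 `stub_localRootBound` (p85053).

For a Bateman–Horn system `f = (f_i)_{i < k}` let `s_{f,p}(n) = Σ_i ([p ∣ f_i(n)] + [p² ∣ f_i(n)])`,
`E_p = Σ_{n < p²} X^{s_{f,p}(n)} ∈ ℂ[X]` (the exact local generating polynomial of the capped statistic at `p`),
`M_y = ∏_{p ≤ y prime} E_p` (the Euler species) and `T(P) = Σ_ρ ‖1 − ρ‖⁻²` over the roots of `P`
(with multiplicity).  THEOREM (all systems, unconditional): `T(M_y) ≤ C_f` for every `y`.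

Proof: `T(M_y) = Σ_{p ≤ y} T(E_p)` (E1); for primes `p ≥ P₁ := max (P₀+1) (8D')`, `D' = 1 + Σ deg f_i`, the
profile of `s_{f,p}` on `range (p²)` given by E2 feeds E3, so `T(E_p) ≤ 128 D'²/p²`; hence
`T(M_y) ≤ Σ_{p < P₁} T(E_p) + 128 D'² Σ_n n⁻²` (abstract summation lemma `euler_sum_bound`).  This is where the
Bateman–Horn hypotheses enter the line: without `irreducible` / `pairwise_not_associated` the local factor is a
polynomial in `z²` with `T(E_p) ≍ 1/p` and the Euler share diverges like `log log y` (refuters' mutations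
`X²`, `(X, X)`).
-/

namespace Summit.Parity.BatemanHorn.Cruxes.SystemZeroRepulsion.EulerSpeciesFactorisation

open Polynomial Finset

/-- Abstract summation over primes: if `g ≥ 0` is additive over the products `∏_{p ≤ y prime} E_p` and
`g(E_p) ≤ B/p²` for all primes `p ≥ P₁`, then `g(∏_{p ≤ y prime} E_p) ≤ Σ_{p < P₁} g(E_p) + B·Σ_n n⁻²`
for every `y`. -/
private theorem euler_sum_bound {g : Polynomial ℂ → ℝ} (hg : ∀ P, 0 ≤ g P) (E : ℕ → Polynomial ℂ)
    {P₁ : ℕ} {B : ℝ} (hB : 0 ≤ B)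
    (hadd : ∀ y : ℕ, g (∏ p ∈ (Finset.range (y + 1)).filter Nat.Prime, E p) =
      ∑ p ∈ (Finset.range (y + 1)).filter Nat.Prime, g (E p))
    (hE : ∀ p : ℕ, p.Prime → P₁ ≤ p → g (E p) ≤ B * (1 / (p : ℝ) ^ 2)) :
    ∃ C : ℝ, ∀ y : ℕ, g (∏ p ∈ (Finset.range (y + 1)).filter Nat.Prime, E p) ≤ C := by
  refine ⟨(∑ p ∈ Finset.range P₁, g (E p)) + B * ∑' n : ℕ, 1 / (n : ℝ) ^ 2, fun y => ?_⟩
  rw [hadd y, ← Finset.sum_filter_add_sum_filter_not ((Finset.range (y + 1)).filter Nat.Prime)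
    (fun p : ℕ => p < P₁)]
  refine add_le_add ?_ ?_
  · refine Finset.sum_le_sum_of_subset_of_nonneg (fun p hp => ?_) (fun p _ _ => hg _)
    simp only [Finset.mem_filter, Finset.mem_range] at hp ⊢
    exact hp.2
  · calc ∑ p ∈ ((Finset.range (y + 1)).filter Nat.Prime).filter (fun p : ℕ => ¬ p < P₁), g (E p)
          ≤ ∑ p ∈ ((Finset.range (y + 1)).filter Nat.Prime).filter (fun p : ℕ => ¬ p < P₁),
            B * (1 / (p : ℝ) ^ 2) := by
            refine Finset.sum_le_sum fun p hp => ?_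
            simp only [Finset.mem_filter, Finset.mem_range, not_lt] at hp
            exact hE p hp.1.2 hp.2
      _ = B * ∑ p ∈ ((Finset.range (y + 1)).filter Nat.Prime).filter
            (fun p : ℕ => ¬ p < P₁), 1 / (p : ℝ) ^ 2 := by rw [Finset.mul_sum]
      _ ≤ B * ∑' n : ℕ, 1 / (n : ℝ) ^ 2 := by
            gcongr
            exact (Real.summable_one_div_nat_pow.mpr one_lt_two).sum_le_tsum _
              (fun n _ => by positivity)

/-- **The Euler share is bounded (planner's stub `stub_eulerSpeciesBound`, all Bateman–Horn systems,
unconditional).** For every Bateman–Horn system `f` there is `C` with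
`T(∏_{p ≤ y prime} E_p) = Σ_{ρ} ‖1−ρ‖⁻² ≤ C` for every `y`, where `E_p = Σ_{n<p²} X^{s_{f,p}(n)}`,
`s_{f,p}(n) = Σ_i ([p ∣ f_i(n)] + [p² ∣ f_i(n)])`.  From E1 (additivity), E2 (generic local structure for
`p > P₀(f)`) and E3 (root bound `T(E_p) ≤ 128D'²/p²`, `D' = 1 + Σ deg f_i`, `p ≥ 8D'`), summed by
`euler_sum_bound`. -/
theorem stub_eulerSpeciesBound :
    ∀ (k : ℕ) (f : Fin k → Polynomial ℤ), Literature.NumberTheory.Sieve.IsBatemanHornSystem f →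
      ∃ C : ℝ, ∀ y : ℕ,
        ((∏ p ∈ (Finset.range (y + 1)).filter Nat.Prime,
            ∑ n ∈ Finset.range (p ^ 2), (Polynomial.X : Polynomial ℂ) ^
              (∑ i, ((if ((p : ℤ) ∣ (f i).eval (n : ℤ)) then 1 else 0) +
                (if ((p : ℤ) ^ 2 ∣ (f i).eval (n : ℤ)) then 1 else 0)))).roots.map
          (fun ρ : ℂ => (‖(1 : ℂ) - ρ‖ ^ 2)⁻¹)).sum ≤ C := by
  intro k f hf
  obtain ⟨P₀, hP₀⟩ := stub_localStructure k f hf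
  have hg : ∀ P : Polynomial ℂ, 0 ≤ (P.roots.map (fun ρ : ℂ => (‖(1 : ℂ) - ρ‖ ^ 2)⁻¹)).sum := by
    intro P
    refine Multiset.sum_nonneg fun v hv => ?_
    obtain ⟨ρ, _, rfl⟩ := Multiset.mem_map.1 hv
    positivity
  refine euler_sum_bound hg
    (fun p : ℕ => ∑ n ∈ Finset.range (p ^ 2), (Polynomial.X : Polynomial ℂ) ^
      (∑ i, ((if ((p : ℤ) ∣ (f i).eval (n : ℤ)) then 1 else 0) +
        (if ((p : ℤ) ^ 2 ∣ (f i).eval (n : ℤ)) then 1 else 0))))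
    (P₁ := max (P₀ + 1) (8 * ((∑ i, (f i).natDegree) + 1)))
    (B := 128 * (((∑ i, (f i).natDegree) + 1 : ℕ) : ℝ) ^ 2) (by positivity)
    (fun y => stub_eulerAdditivity k f y) (fun p hp hp1 => ?_)
  have hP₀p : P₀ < p := lt_of_lt_of_le (Nat.lt_succ_self P₀) (le_trans (le_max_left _ _) hp1)
  have h8 : 8 * ((∑ i, (f i).natDegree) + 1) ≤ p := le_trans (le_max_right _ _) hp1
  obtain ⟨h2, hne, heq⟩ := hP₀ p hp hP₀p
  rw [mul_one_div]
  exact stub_localRootBound p ((∑ i, (f i).natDegree) + 1)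
    (fun n : ℕ => ∑ i, ((if ((p : ℤ) ∣ (f i).eval (n : ℤ)) then 1 else 0) +
      (if ((p : ℤ) ^ 2 ∣ (f i).eval (n : ℤ)) then 1 else 0)))
    (Nat.succ_le_succ (Nat.zero_le _)) h8 (fun n _ => h2 n)
    (le_trans hne (Nat.mul_le_mul_right p (Nat.le_succ _))) (le_trans heq (Nat.le_succ _))


/-- **The Euler share converges.** For every Bateman–Horn system the Euler share `T(∏_{p ≤ y prime} E_p)` is
non-decreasing in `y` (by additivity E1 it is a partial sum of the non-negative series `Σ_p T(E_p)`) and bounded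
(`stub_eulerSpeciesBound`), hence converges as `y → ∞` (to `Σ_p T(E_p)`, the explicit-small-prime part of the predicted limit of
the crux functional). -/
theorem eulerSpecies_tendsto :
    ∀ (k : ℕ) (f : Fin k → Polynomial ℤ), Literature.NumberTheory.Sieve.IsBatemanHornSystem f →
      ∃ T₀ : ℝ, Filter.Tendsto (fun y : ℕ =>
        ((∏ p ∈ (Finset.range (y + 1)).filter Nat.Prime,
            ∑ n ∈ Finset.range (p ^ 2), (Polynomial.X : Polynomial ℂ) ^
              (∑ i, ((if ((p : ℤ) ∣ (f i).eval (n : ℤ)) then 1 else 0) +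
                (if ((p : ℤ) ^ 2 ∣ (f i).eval (n : ℤ)) then 1 else 0)))).roots.map
          (fun ρ : ℂ => (‖(1 : ℂ) - ρ‖ ^ 2)⁻¹)).sum) Filter.atTop (nhds T₀) := by
  intro k f hf
  obtain ⟨C, hC⟩ := stub_eulerSpeciesBound k f hf
  have hg : ∀ P : Polynomial ℂ, 0 ≤ (P.roots.map (fun ρ : ℂ => (‖(1 : ℂ) - ρ‖ ^ 2)⁻¹)).sum := by
    intro P
    refine Multiset.sum_nonneg fun v hv => ?_
    obtain ⟨ρ, _, rfl⟩ := Multiset.mem_map.1 hv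
    positivity
  refine ⟨_, tendsto_atTop_ciSup (fun y y' hyy' => ?_) ⟨C, ?_⟩⟩
  · -- monotonicity: by E1 both sides are sums of the non-negative `T(E_p)` over the primes `≤ y`, `≤ y'`
    rw [stub_eulerAdditivity k f y, stub_eulerAdditivity k f y']
    refine Finset.sum_le_sum_of_subset_of_nonneg (fun p hp => ?_) (fun p _ _ => hg _)
    simp only [Finset.mem_filter, Finset.mem_range] at hp ⊢
    exact ⟨by omega, hp.2⟩
  · rintro _ ⟨y, rfl⟩
    exact hC y

end Summit.Parity.BatemanHorn.Cruxes.SystemZeroRepulsion.EulerSpeciesFactorisation
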